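import Summits.QuantumFields.YangMills.Theorems.BalabanUVNodesN19TiltPathGaussianTwoRuns

/-!
# BalabanUVNodes ∕ node N19 (NE7 bracket) → apex — THE ANNEALED ROAD INSTANTIATED IN KING'S GAUSSIAN MODEL: NE7's `MatchingModConstants`, `Spine.NE7.Core` and the Cauchy
# property of the generating functions of the FULL-SPACE effective measures `∫ e^{−½φ·Δ^{(K+1)}φ}e^{tWφ}dφ`, with NO small-field∕large-field split and NO numeric hypothesis

Cell `pub-ymgap`, HUMAN RULING D-0062 (Track A), R134 ACCELERATION seat `pub-ymgap-dag-n19-c` (N19 NE7, strategy s1), generation 12, module 19b; route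
`Summits/QuantumFields/YangMills/Theses/BalabanUVNodes.lean` rev 19 (K3⁗ `SpineGivenEndpointR13Sep` = stmt-QuantumFields-20292, `--supports … --as helper`); venue R424
(namespace `Summit.QuantumFields.YangMills.BalabanUVNodes.N19TiltPathKingModel`).  ADDITIVE — imports this seat's `…N19TiltPathGaussianTwoRuns` (★★★
`abs_log_sub_log_sub_le_of_actionBound`) and through it n14-c's `…N18KingModelLargeField` (`effLaplacian_coercive_unif`, `gamma0_pos`, `dressedZ_full_pos`), `…KingModelDensTorus`
(`abs_action_sub_le_torus_of_eq` = King's Prop. 3.10 (3.92) at the operators), `…KingModelDens` (`kingTheta_nonneg`, `summable_kingRadius`), the tree's `King1986` files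
(`Torus.effLaplacian`, `aK`, `thetaK`, `aminL`), `T4CauchySum` (`MatchingModConstants`, `genFun`, `genFunLim`, `cauchySeq_genFun`, `tendstoUniformlyOn_genFun`, `two_sided_of_abs_log_sub_le` = the `Core` clause shape from `|log Q − log P − c| ≤ w`), `Spine/NE7/Targets`
(`Core`) — all CITED, nothing re-proved; THEOREMS ONLY (0 `def`), modifies nothing.
* §1 [folklore ∘ 19a + n14-c's King files] ★★ `abs_log_sub_log_sub_le_king` (the annealed two-run bound at `Δ^{(K+1)}`, `Δ^{(K+2)}`: `(e^{2|t|B} − 1)·θ_{K+1}·a·|Tor M|∕(2γ₀)`),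
  ★★ **`matchingModConstants_kingFullSpace`** (NE7 `MatchingModConstants vol l₀ δ Z` for the FULL-SPACE `Z K t` of n14-c's `cauchy_genFun_kingTwoClass`, with
  `δ_K = (e^{2l₀B} − 1)·θ_{K+1}·a·|Tor M|∕(2γ₀·vol)`, constant = the free-energy difference), `summable_delta_kingFullSpace`, ★★★ **`cauchy_genFun_kingFullSpace`**
  (`MatchingModConstants ∧ Summable ∧ (∀ |t| ≤ l₀, CauchySeq genFun) ∧ TendstoUniformlyOn` — hypotheses: `a, m² > 0`, `L ≥ 2`, `vol > 0`, `l₀ ≥ 0`, bounded measurable `W`, NOTHING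
  ELSE), ★ `core_kingFullSpace` (`Spine.NE7.Core` with ONE class `Unit` and `Bad = ∅` on the whole field space), `exists_core_summable_kingFullSpace` (the K3⁗ keyed-core-edge
  conclusion shape `∃ δ, Core ∧ Summable δ`, inhabited WITHOUT a bad class); v1.1 ★★ `hybridNE7_kingFullSpace` (the spine's `T4MatchingAssembly.HybridNE7` with `Bad = ∅`,
  weights `0`, shells `0` — honestly, on the whole field space — via `hybridNE7_noShell` + n14-c's `relWeightBound_empty`).
COMPARISON (one line).  n14-c's `KingModelLargeField.cauchy_genFun_kingTwoClass` ∕ `KingModelGaussianLimit.cauchy_genFun_kingGaussian` reach the same apex statement for the same `Z`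
by the DENS road (small-field box of radius `R_K`, large-field weight `e^{2l₀B}√2^{|Tor M|}e^{−γ₀R_K²∕4} < 1` — one numeric hypothesis); the annealed road replaces `R_K²` by the
thermal size `(e^{2l₀B} − 1)∕γ₀` and leaves no hypothesis: in the Gaussian template a bounded source is second-moment-perturbative on the WHOLE field space.

HONEST FRAMING.  King's `A = 0` scalar MODEL with periodic boundary conditions and `m² > 0` ([King1986]; template literature) — NOT Bałaban's NE7 ∕ NE7b for gauge fields (NOT
PRINTED; NODE O ∕ N20 objects), where the action difference is NOT second-moment-small on large fields; nothing of Bałaban's is instantiated or asserted.  Count-neutral; N18 ∕ N19 ∕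
N20 ∕ N27 NOT discharged; counts UNMOVED.  Everything is PROVED (0 `sorry`, 0 named facts).  One finite four-torus programme at fixed ε; NOT ℝ⁴, NOT OS, NOT a mass gap, NOT Clay.
-/

noncomputable section

namespace Summit.QuantumFields.YangMills.BalabanUVNodes.N19TiltPathKingModel

open MeasureTheory Set Filter Real Matrix Topology
open scoped BigOperators
open Literature.MathematicalPhysics.QuantumFieldTheory.Balaban1983to89.B5Prop11Plancherel (Tor)
open Literature.MathematicalPhysics.QuantumFieldTheory.Balaban1983to89.QGQInverse (Coercive)
open Literature.MathematicalPhysics.QuantumFieldTheory.Balaban1983to89.T4CauchySum (MatchingModConstants genFun genFunLim cauchySeq_genFun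
  tendstoUniformlyOn_genFun two_sided_of_abs_log_sub_le)
open Literature.MathematicalPhysics.QuantumFieldTheory.King1986 (aK thetaK)
open Literature.MathematicalPhysics.QuantumFieldTheory.King1986.Torus (effLaplacian aminL)
open Summit.QuantumFields.BalabanUV.T4Continuum.Spine.NE7 (Core)
open YMDAG.N18.KingModelDens (kingTheta_nonneg summable_kingRadius)
open YMDAG.N18.KingModelDensTorus (abs_action_sub_le_torus_of_eq)
open YMDAG.N18.KingModelLargeField (effLaplacian_coercive_unif gamma0_pos dressedZ_full_pos)
open YMDAG.N18.KingModelCauchy (relWeightBound_empty)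
open Literature.MathematicalPhysics.QuantumFieldTheory.Balaban1983to89.T4MatchingAssembly (HybridNE7 hybridNE7_noShell)
open Summit.QuantumFields.YangMills.BalabanUVNodes.N19TiltPathGaussianTwoRuns (abs_log_sub_log_sub_le_of_actionBound)

variable {d : ℕ} (M : Fin d → ℕ) [hM : ∀ μ, NeZero (M μ)]

/-! ## §1 The annealed road at King's effective Laplacians: consecutive runs on the full field space -/
section King

variable {l₀ vol B : ℝ} {W : (Tor M → ℝ) → ℝ} {Z : ℕ → ℝ → ℝ}

/-- **★★ THE ANNEALED TWO-RUN BOUND AT KING'S OPERATORS** [folklore ∘ `N19TiltPathGaussian` + n14-c's `abs_action_sub_le_torus`, `effLaplacian_coercive_unif`]: run A = `Δ^{(K+1)}`,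
run B = `Δ^{(K+2)}` (King's block-RG effective Laplacians on the unit torus `Tor M`, both `γ₀`-coercive, `γ₀ = ((a(1−L⁻²))⁻¹ + m⁻²)⁻¹`, with
`|½φ·Δ^{(K+1)}φ − ½φ·Δ^{(K+2)}φ| ≤ θ_{K+1}·a·(φ·φ)∕2`); for a bounded measurable `W` (`|W| ≤ B`) and EVERY source `t`, the FULL-SPACE dressed partition functions satisfy
`|log Z_B(t) − log Z_A(t) − (log Z_B(0) − log Z_A(0))| ≤ (e^{2|t|B} − 1)·θ_{K+1}·a·|Tor M|∕(2γ₀)`.  No small-field class, no radius, no numeric hypothesis.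
[cite: King1986, Prop 3.10 (3.91)–(3.92) p.669; (4.33)–(4.35) p.674] -/
theorem abs_log_sub_log_sub_le_king {a : ℝ} (ha : 0 < a) {L : ℕ} [NeZero L] (hL : 2 ≤ L) {m2 : ℝ} (hm : 0 < m2) (hWm : Measurable W)
    (hWb : ∀ φ, |W φ| ≤ B) (K : ℕ) (t : ℝ) :
    |Real.log (∫ φ : Tor M → ℝ, Real.exp (-(φ ⬝ᵥ (effLaplacian (L ^ (K + 1 + 1)) M (aK a L (K + 1 + 1)) (((L ^ (K + 1 + 1) : ℕ) : ℝ) ^ 2) m2 *ᵥ φ) / 2))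
          * Real.exp (t * W φ))
        - Real.log (∫ φ : Tor M → ℝ, Real.exp (-(φ ⬝ᵥ (effLaplacian (L ^ (K + 1)) M (aK a L (K + 1)) (((L ^ (K + 1) : ℕ) : ℝ) ^ 2) m2 *ᵥ φ) / 2))
          * Real.exp (t * W φ))
        - (Real.log (∫ φ : Tor M → ℝ, Real.exp (-(φ ⬝ᵥ (effLaplacian (L ^ (K + 1 + 1)) M (aK a L (K + 1 + 1)) (((L ^ (K + 1 + 1) : ℕ) : ℝ) ^ 2) m2 *ᵥ φ) / 2))
              * Real.exp (0 * W φ))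
            - Real.log (∫ φ : Tor M → ℝ, Real.exp (-(φ ⬝ᵥ (effLaplacian (L ^ (K + 1)) M (aK a L (K + 1)) (((L ^ (K + 1) : ℕ) : ℝ) ^ 2) m2 *ᵥ φ) / 2))
              * Real.exp (0 * W φ)))|
      ≤ (Real.exp (2 * (|t| * B)) - 1) * (thetaK a L (K + 1) 1 * a) * Fintype.card (Tor M) / (2 * ((aminL a L)⁻¹ + m2⁻¹)⁻¹) :=
  abs_log_sub_log_sub_le_of_actionBound M (gamma0_pos ha hL hm) (mul_nonneg (kingTheta_nonneg ha hL (by omega) le_rfl) ha.le)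
    (effLaplacian_coercive_unif M ha hL (by omega) hm) (effLaplacian_coercive_unif M ha hL (by omega) hm)
    (fun φ => abs_action_sub_le_torus_of_eq M ha hL (k := K + 1) (n := 1) (by omega) le_rfl hm (L ^ (K + 1 + 1))
      (by rw [pow_one, pow_succ, mul_comm]) (K + 1 + 1) rfl φ)
    hWm hWb t

/-- **★★ NE7's `MatchingModConstants` FOR KING'S FULL-SPACE GAUSSIAN EFFECTIVE MEASURES, UNCONDITIONALLY** [folklore ∘ `abs_log_sub_log_sub_le_king`]: with
`Z K t = ∫ exp(−½φ·Δ^{(K+1)}φ)·e^{tW φ} dφ` over the WHOLE unit-lattice field space, for `a, m² > 0`, `L ≥ 2`, `vol > 0` and a bounded measurable `W`: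
`T4CauchySum.MatchingModConstants vol l₀ δ Z` with `δ_K = (e^{2l₀B} − 1)·θ_{K+1}·a·|Tor M|∕(2γ₀·vol)`, the constant being the free-energy difference `log Z_{K+1}(0) − log Z_K(0)`.
Compare n14-c's `cauchy_genFun_kingTwoClass` (DENS road: small-field radius `R_K` + the large-field weight condition `e^{2l₀B}√2^{|Tor M|}e^{−γ₀R_K²∕4} < 1`): here the radius is
replaced by the thermal size `(e^{2l₀B} − 1)∕γ₀` and NO hypothesis on the field is left. -/
theorem matchingModConstants_kingFullSpace {a : ℝ} (ha : 0 < a) {L : ℕ} [NeZero L] (hL : 2 ≤ L) {m2 : ℝ} (hm : 0 < m2) (hvol : 0 < vol)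
    (hWm : Measurable W) (hWb : ∀ φ, |W φ| ≤ B)
    (hZ : ∀ K (t : ℝ), Z K t = ∫ φ : Tor M → ℝ,
      Real.exp (-(φ ⬝ᵥ (effLaplacian (L ^ (K + 1)) M (aK a L (K + 1)) (((L ^ (K + 1) : ℕ) : ℝ) ^ 2) m2 *ᵥ φ) / 2)) * Real.exp (t * W φ)) :
    MatchingModConstants vol l₀
      (fun K => (Real.exp (2 * (l₀ * B)) - 1) * (thetaK a L (K + 1) 1 * a) * Fintype.card (Tor M) / (2 * ((aminL a L)⁻¹ + m2⁻¹)⁻¹) / vol) Z := by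
  intro K
  refine ⟨Real.log (Z (K + 1) 0) - Real.log (Z K 0), fun t ht => ?_⟩
  have hγ := gamma0_pos ha hL hm
  have hB : 0 ≤ B := (abs_nonneg _).trans (hWb fun _ => 0)
  have hθ : 0 ≤ thetaK a L (K + 1) 1 * a := mul_nonneg (kingTheta_nonneg ha hL (by omega) le_rfl) ha.le
  have hexp : Real.exp (2 * (|t| * B)) - 1 ≤ Real.exp (2 * (l₀ * B)) - 1 :=
    sub_le_sub_right (Real.exp_le_exp.2 (by nlinarith [abs_nonneg t])) 1
  have hcard : (0 : ℝ) ≤ Fintype.card (Tor M) := Nat.cast_nonneg _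
  rw [hZ (K + 1) t, hZ K t, hZ (K + 1) 0, hZ K 0]
  calc _ ≤ (Real.exp (2 * (|t| * B)) - 1) * (thetaK a L (K + 1) 1 * a) * Fintype.card (Tor M) / (2 * ((aminL a L)⁻¹ + m2⁻¹)⁻¹) :=
        abs_log_sub_log_sub_le_king M ha hL hm hWm hWb K t
    _ ≤ (Real.exp (2 * (l₀ * B)) - 1) * (thetaK a L (K + 1) 1 * a) * Fintype.card (Tor M) / (2 * ((aminL a L)⁻¹ + m2⁻¹)⁻¹) := by
        gcongr
    _ = vol * ((Real.exp (2 * (l₀ * B)) - 1) * (thetaK a L (K + 1) 1 * a) * Fintype.card (Tor M) / (2 * ((aminL a L)⁻¹ + m2⁻¹)⁻¹) / vol) := by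
        field_simp

/-- … with a SUMMABLE remainder: `δ_K ∝ θ_{K+1}` is geometric (n14-c's `summable_kingRadius`, tree `thetaK_le`). [folklore] -/
theorem summable_delta_kingFullSpace {a : ℝ} (ha : 0 < a) {L : ℕ} (hL : 2 ≤ L) (m2 l₀ vol B : ℝ) :
    Summable fun K : ℕ =>
      (Real.exp (2 * (l₀ * B)) - 1) * (thetaK a L (K + 1) 1 * a) * Fintype.card (Tor M) / (2 * ((aminL a L)⁻¹ + m2⁻¹)⁻¹) / vol := by
  have h := ((summable_kingRadius ha hL (n := 1) le_rfl (M := (1 : ℝ)) zero_le_one 0).1.mul_left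
    ((Real.exp (2 * (l₀ * B)) - 1) * Fintype.card (Tor M) / ((aminL a L)⁻¹ + m2⁻¹)⁻¹ / vol))
  refine h.congr fun K => ?_
  ring

/-- **★★★ THE CAUCHY PROPERTY OF THE GENERATING FUNCTIONS OF KING'S FULL-SPACE GAUSSIAN EFFECTIVE MEASURES — NO LARGE-FIELD HYPOTHESIS** [folklore ∘ the two theorems above +
`T4CauchySum.cauchySeq_genFun` ∕ `tendstoUniformlyOn_genFun`]: `Z K t = ∫ exp(−½φ·Δ^{(K+1)}φ)·e^{tWφ} dφ` on the WHOLE field space; hypotheses = the model's data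
(`a, m² > 0`, `L ≥ 2`), `vol > 0`, `l₀ ≥ 0` and a bounded measurable `W` ONLY: NE7 `MatchingModConstants vol l₀ δ Z` with `Σ δ_K < ∞`, `CauchySeq (K ↦ genFun Z K t)` for every
`|t| ≤ l₀`, and uniform convergence of the generating functions on the window.  The conditioned sibling is n14-c's `KingModelLargeField.cauchy_genFun_kingTwoClass` (same `Z`,
plus radii `R_K` and the weight condition); the annealed (tilt-path) road of this seat's g9 modules removes every condition in the Gaussian template.  HONEST: King's `A = 0`
scalar MODEL; NOT Bałaban's NE7; count-neutral. -/
theorem cauchy_genFun_kingFullSpace {a : ℝ} (ha : 0 < a) {L : ℕ} [NeZero L] (hL : 2 ≤ L) {m2 : ℝ} (hm : 0 < m2) (hvol : 0 < vol) (hl₀ : 0 ≤ l₀)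
    (hWm : Measurable W) (hWb : ∀ φ, |W φ| ≤ B)
    (hZ : ∀ K (t : ℝ), Z K t = ∫ φ : Tor M → ℝ,
      Real.exp (-(φ ⬝ᵥ (effLaplacian (L ^ (K + 1)) M (aK a L (K + 1)) (((L ^ (K + 1) : ℕ) : ℝ) ^ 2) m2 *ᵥ φ) / 2)) * Real.exp (t * W φ)) :
    MatchingModConstants vol l₀
        (fun K => (Real.exp (2 * (l₀ * B)) - 1) * (thetaK a L (K + 1) 1 * a) * Fintype.card (Tor M) / (2 * ((aminL a L)⁻¹ + m2⁻¹)⁻¹) / vol) Z ∧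
      (Summable fun K : ℕ =>
        (Real.exp (2 * (l₀ * B)) - 1) * (thetaK a L (K + 1) 1 * a) * Fintype.card (Tor M) / (2 * ((aminL a L)⁻¹ + m2⁻¹)⁻¹) / vol) ∧
      (∀ t : ℝ, |t| ≤ l₀ → CauchySeq fun K => genFun Z K t) ∧
      TendstoUniformlyOn (fun K t => genFun Z K t) (genFunLim Z) atTop {t | |t| ≤ l₀} := by
  have hMC := matchingModConstants_kingFullSpace M ha hL hm hvol hWm hWb (l₀ := l₀) hZ
  have hS := summable_delta_kingFullSpace M ha hL m2 l₀ vol B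
  exact ⟨hMC, hS, fun t ht => cauchySeq_genFun hMC hl₀ hS ht, tendstoUniformlyOn_genFun hMC hl₀ hS⟩

/-- **★ N19's `Spine.NE7.Core` WITH ONE CLASS AND NO BAD CLASS** [folklore ∘ `matchingModConstants_kingFullSpace` + `T4CauchySum.two_sided_of_abs_log_sub_le`]: class index `Unit`, `Bad = ∅`, run A = `Δ^{(K+1)}`, run B =
`Δ^{(K+2)}`, both read on the WHOLE field space; `Core l₀ vol univ ∅ A B δ` with the annealed `δ`.  (n14-c's `core_kingTwoClass` needs the small-field class and excludes the bad one.) -/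
theorem core_kingFullSpace {a : ℝ} (ha : 0 < a) {L : ℕ} [NeZero L] (hL : 2 ≤ L) {m2 : ℝ} (hm : 0 < m2) (hvol : 0 < vol) (hWm : Measurable W)
    (hWb : ∀ φ, |W φ| ≤ B) :
    Core l₀ vol (fun _ => (Finset.univ : Finset Unit)) (fun _ _ => (∅ : Finset Unit))
      (fun K t _ => ∫ φ : Tor M → ℝ,
        Real.exp (-(φ ⬝ᵥ (effLaplacian (L ^ (K + 1)) M (aK a L (K + 1)) (((L ^ (K + 1) : ℕ) : ℝ) ^ 2) m2 *ᵥ φ) / 2)) * Real.exp (t * W φ))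
      (fun K t _ => ∫ φ : Tor M → ℝ,
        Real.exp (-(φ ⬝ᵥ (effLaplacian (L ^ (K + 1 + 1)) M (aK a L (K + 1 + 1)) (((L ^ (K + 1 + 1) : ℕ) : ℝ) ^ 2) m2 *ᵥ φ) / 2)) * Real.exp (t * W φ))
      fun K => (Real.exp (2 * (l₀ * B)) - 1) * (thetaK a L (K + 1) 1 * a) * Fintype.card (Tor M) / (2 * ((aminL a L)⁻¹ + m2⁻¹)⁻¹) / vol := by
  have hγ := gamma0_pos ha hL hm
  have hMC := matchingModConstants_kingFullSpace M ha hL hm hvol hWm hWb (l₀ := l₀)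
    (Z := fun K t => ∫ φ : Tor M → ℝ,
      Real.exp (-(φ ⬝ᵥ (effLaplacian (L ^ (K + 1)) M (aK a L (K + 1)) (((L ^ (K + 1) : ℕ) : ℝ) ^ 2) m2 *ᵥ φ) / 2)) * Real.exp (t * W φ))
    (fun K t => rfl)
  intro K
  obtain ⟨c, hc⟩ := hMC K
  refine ⟨c, fun t ht τ _ => two_sided_of_abs_log_sub_le ?_ ?_ (hc t ht)⟩
  · exact dressedZ_full_pos M hγ (effLaplacian_coercive_unif M ha hL (by omega) hm) hWm hWb t
  · exact dressedZ_full_pos M hγ (effLaplacian_coercive_unif M ha hL (by omega) hm) hWm hWb t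

/-- **THE K3⁗ KEYED-CORE-EDGE CONCLUSION SHAPE `∃ δ, Core … δ ∧ Summable δ`, INHABITED WITHOUT A BAD CLASS** in King's Gaussian model [folklore ∘ the two theorems above]. -/
theorem exists_core_summable_kingFullSpace {a : ℝ} (ha : 0 < a) {L : ℕ} [NeZero L] (hL : 2 ≤ L) {m2 : ℝ} (hm : 0 < m2) (hvol : 0 < vol)
    (hWm : Measurable W) (hWb : ∀ φ, |W φ| ≤ B) :
    ∃ δ : ℕ → ℝ, Core l₀ vol (fun _ => (Finset.univ : Finset Unit)) (fun _ _ => (∅ : Finset Unit))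
      (fun K t _ => ∫ φ : Tor M → ℝ,
        Real.exp (-(φ ⬝ᵥ (effLaplacian (L ^ (K + 1)) M (aK a L (K + 1)) (((L ^ (K + 1) : ℕ) : ℝ) ^ 2) m2 *ᵥ φ) / 2)) * Real.exp (t * W φ))
      (fun K t _ => ∫ φ : Tor M → ℝ,
        Real.exp (-(φ ⬝ᵥ (effLaplacian (L ^ (K + 1 + 1)) M (aK a L (K + 1 + 1)) (((L ^ (K + 1 + 1) : ℕ) : ℝ) ^ 2) m2 *ᵥ φ) / 2)) * Real.exp (t * W φ)) δ ∧
      Summable δ :=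
  ⟨_, core_kingFullSpace M ha hL hm hvol hWm hWb, summable_delta_kingFullSpace M ha hL m2 l₀ vol B⟩

/-- **★★ (v1.1) THE SPINE's NE7 ASSEMBLY `HybridNE7` INHABITED BY KING'S FULL-SPACE GAUSSIAN MODEL WITH NO BAD CLASS AND NO FIAT** [folklore ∘ `matchingModConstants_kingFullSpace` +
`T4MatchingAssembly.hybridNE7_noShell` + n14-c's `KingModelCauchy.relWeightBound_empty`]: class index `Unit`, `Bad = ∅`, weights `0`, shells `0`, run A = `Z K`, run B = `Z (K+1)` — the
FULL-SPACE partition functions of `cauchy_genFun_kingFullSpace` — and the annealed `δ`.  Compare n14-c's `hybridNE7_kingSmallField` (bad class empty BY FIAT, `Z` restricted to the box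
`|φ(x)| ≤ R`) and `hybridNE7_kingTwoClass` (genuine bad class, numeric weight condition): here the bad class is empty HONESTLY, on the whole field space, by the annealed road. -/
theorem hybridNE7_kingFullSpace {a : ℝ} (ha : 0 < a) {L : ℕ} [NeZero L] (hL : 2 ≤ L) {m2 : ℝ} (hm : 0 < m2) (hvol : 0 < vol) (hWm : Measurable W)
    (hWb : ∀ φ, |W φ| ≤ B)
    (hZ : ∀ K (t : ℝ), Z K t = ∫ φ : Tor M → ℝ,
      Real.exp (-(φ ⬝ᵥ (effLaplacian (L ^ (K + 1)) M (aK a L (K + 1)) (((L ^ (K + 1) : ℕ) : ℝ) ^ 2) m2 *ᵥ φ) / 2)) * Real.exp (t * W φ)) :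
    HybridNE7 l₀ vol (fun _ => (Finset.univ : Finset Unit)) (fun K t _ => Z K t) (fun K t _ => Z (K + 1) t) (fun _ _ => (∅ : Finset Unit)) (fun _ => 0)
      (fun _ _ _ => 0) (fun _ _ _ => 0) (fun _ => 0)
      fun K => (Real.exp (2 * (l₀ * B)) - 1) * (thetaK a L (K + 1) 1 * a) * Fintype.card (Tor M) / (2 * ((aminL a L)⁻¹ + m2⁻¹)⁻¹) / vol := by
  have hγ := gamma0_pos ha hL hm
  have hZpos : ∀ K (t : ℝ), 0 < Z K t := fun K t => by
    rw [hZ K t]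
    exact dressedZ_full_pos M hγ (effLaplacian_coercive_unif M ha hL (by omega) hm) hWm hWb t
  have hMC := matchingModConstants_kingFullSpace M ha hL hm hvol hWm hWb (l₀ := l₀) hZ
  refine hybridNE7_noShell relWeightBound_empty (fun K t _ _ _ => (hZpos K t).le) (fun K t _ _ _ => (hZpos (K + 1) t).le)
    (summable_delta_kingFullSpace M ha hL m2 l₀ vol B) fun K => ?_
  obtain ⟨c, hc⟩ := hMC K
  exact ⟨c, fun t ht τ _ => two_sided_of_abs_log_sub_le (hZpos K t) (hZpos (K + 1) t) (hc t ht)⟩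

end King

end Summit.QuantumFields.YangMills.BalabanUVNodes.N19TiltPathKingModel

end
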